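import Literature.AnabelianGeometry.AbsoluteAnabelian.AbsTopIII.Cor110Natural
import Literature.AnabelianGeometry.EtaleTheta.SettingModel
import Literature.NumberTheory.EllipticCurves.TateJTransport
import HarnessLib

/-!
# The «strictly Belyi type» guard of [AbsTopIII] Cor. 1.10 (iii) is FALSE at the synthetic
# [EtTh] §1 models (`q_X = p²`, `q_X = p^k`): the typed fact holds there vacuously

Everything in this file is PROVED; no definitions, no named facts, nothing of [AbsTopIII] / [EtTh] /
[IUTchI–III] is asserted.

The tree types [AbsTopIII] Cor. 1.10 (iii) (Mochizuki, PRIMS **51** (2015); the result Scholze–Stix 2018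
§2.1.2 quote as their Theorem 7 / Remark 9, ms. p. 5: «this functor is fully faithful … there are no
additional isomorphisms of fundamental groups that do not come from isomorphisms of schemes») at printed
strength on the [EtTh] §1 interface as
`Cor_1_10_iii_natural D := IsAlgebraic ℚ (tateJ D.qX) → ∀ H ≤ Π^tp_X open of finite index, (HGAL)`
(`Cor110Natural.lean`), the guard `IsAlgebraic ℚ (tateJ D.qX)` rendering the printed hypothesis «`X` is of
strictly Belyi type» as «`j(E_{q_X}) ∈ ℚ̄`» [cite: MochizukiAbsTopIII2015, Cor 1.10 (iii) p.43].  At the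
cell's genuine data the guard holds (`j ∈ F`).  At the SYNTHETIC consistency models of the interface
(`ThetaSetting.model p` and its refinements, all with `q_X = qModel p = p²`, and the `q_X = p` variants)
the guard is FALSE: `j(p^k)` is transcendental for `k ≠ 0` by the `p`-adic Mahler–Manin theorem of
Barré-Sirieix–Diaz–Gramain–Philibert (Invent. Math. **124** (1996), Théorème 1), PROVED in the tree as
`Literature.NumberTheory.Transcendental.MahlerManinPadic_holds` and transported to `ℚ̄_p = PadicAlgCl p`
in `Literature.NumberTheory.EllipticCurves.TateJTransport`
[cite: BarreSirieixDiazGramainPhilibert1996Manin, Théorème 1].  Consequently the typed fact HOLDS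
VACUOUSLY at every such model and no such model can supply the origin datum
`hj : IsAlgebraic ℚ (tateJ D.qX)` of its consumers — a kernel DECISION of a census cell previously
recorded as «undecided in kernel» (abc-iut cell, K-L6 note, 2026-08-26).

* `not_isAlgebraic_tateJ_of_qX_eq_natCast_pow`, `cor_1_10_iii_natural_of_qX_eq_natCast_pow` — for ANY
  `D : ThetaSetting p` with `D.qX = p^k`, `k ≠ 0`;
* `not_isAlgebraic_tateJ_qModel` (`qModel p = p²`), `not_isAlgebraic_tateJ_model_qX`,
  `cor_1_10_iii_natural_model` — the base model `ThetaSetting.model p` of `SettingModel.lean`; the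
  refinements (`model₂`, the `χ`/Tate/Krull/Y-twist variants) have `qX := qModel p` definitionally and are
  served by the generic lemmas with `rfl`.

HONEST FRAMING: vacuous truth at a synthetic model says nothing about the genuine tempered `π₁`, about
[AbsTopIII] Cor. 1.10 (iii) itself (a refereed theorem, consumed BY NAME), or about [IUTchIII] Cor. 3.12;
typed ≠ proved for the fact at genuine data; nothing here bears on the truth of abc.
-/

noncomputable section

namespace Literature.AnabelianGeometry.AbsoluteAnabelian.AbsTopIII

open Literature.AnabelianGeometry.EtaleTheta Literature.NumberTheory.EllipticCurves

variable (p : ℕ) [Fact p.Prime]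

/-- For a `ThetaSetting` whose Tate parameter is a synthetic `q_X = p^k` (`k ≠ 0`), the guard
«`j(E_{q_X}) ∈ ℚ̄`» is FALSE: `j(p^k) ∈ ℚ̄_p` is transcendental (Mahler–Manin, BDGP 1996).
[cite: BarreSirieixDiazGramainPhilibert1996Manin, Théorème 1] -/
theorem not_isAlgebraic_tateJ_of_qX_eq_natCast_pow (D : ThetaSetting p) {k : ℕ} (hk : k ≠ 0)
    (h : D.qX = (p : PadicAlgCl p) ^ k) : ¬ IsAlgebraic ℚ (tateJ D.qX) := by
  rw [h]
  exact not_isAlgebraic_tateJ_natCast_pow_padicAlgCl p hk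

/-- **The typed [AbsTopIII] Cor. 1.10 (iii) holds VACUOUSLY at every `ThetaSetting` with synthetic Tate
parameter `q_X = p^k`, `k ≠ 0`** (its guard fails there).
[cite: MochizukiAbsTopIII2015, Cor 1.10 (iii) p.43] -/
theorem cor_1_10_iii_natural_of_qX_eq_natCast_pow (D : ThetaSetting p) {k : ℕ} (hk : k ≠ 0)
    (h : D.qX = (p : PadicAlgCl p) ^ k) : Cor_1_10_iii_natural D :=
  fun hj ↦ absurd hj (not_isAlgebraic_tateJ_of_qX_eq_natCast_pow p D hk h)

/-- `j(qModel p) = j(p²) ∈ ℚ̄_p` is transcendental: the guard fails at the models' common Tate parameter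
`qModel p = p²` (`SettingModel.lean`). [cite: BarreSirieixDiazGramainPhilibert1996Manin, Théorème 1] -/
theorem not_isAlgebraic_tateJ_qModel : ¬ IsAlgebraic ℚ (tateJ (SettingModel.qModel p)) :=
  not_isAlgebraic_tateJ_natCast_pow_padicAlgCl p two_ne_zero

/-- The guard «`j(E_{q_X}) ∈ ℚ̄`» is FALSE at the base synthetic model `ThetaSetting.model p`
(`q_X = p²`). [cite: BarreSirieixDiazGramainPhilibert1996Manin, Théorème 1] -/
theorem not_isAlgebraic_tateJ_model_qX : ¬ IsAlgebraic ℚ (tateJ (ThetaSetting.model p).qX) :=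
  not_isAlgebraic_tateJ_of_qX_eq_natCast_pow p (ThetaSetting.model p) two_ne_zero rfl

/-- **The typed [AbsTopIII] Cor. 1.10 (iii) holds VACUOUSLY at the base synthetic model
`ThetaSetting.model p`** — so this model decides the fact's instance (true, vacuously) and can never supply
the origin datum `hj` of the fact's consumers. [cite: MochizukiAbsTopIII2015, Cor 1.10 (iii) p.43] -/
theorem cor_1_10_iii_natural_model : Cor_1_10_iii_natural (ThetaSetting.model p) :=
  cor_1_10_iii_natural_of_qX_eq_natCast_pow p (ThetaSetting.model p) two_ne_zero rfl

end Literature.AnabelianGeometry.AbsoluteAnabelian.AbsTopIII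

end
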